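import Summits.HodgeConjecture.HodgeConjecture.Theorems.F0P2rFamTransferHolds   -- ★ p842415: split-place plumbing for theta-`P` (X-side split model ★ p817128, transport ★ p816908, `isConstituentOf_of_isotypicComponent_eq_top`); REL-ENGINE statement vocabulary
import Summits.HodgeConjecture.HodgeConjecture.Theorems.F0P3FinPartIsotypic      -- ★ Flath: `isotypicComponent_finRep_smoothPart_eq_top` (the finite part of `P` is isotypic of its type)
import Summits.HodgeConjecture.HodgeConjecture.Theorems.F0P2iGRDWitness          -- ★ p819322: `splitNu0_eq_localComponent_of_pin`, `locPsi_eq_wReading_mul_zpow_of_pins` ((Dν), (Dψ) from the two global pins, for EVERY pair `(μ, χf)`)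
import Literature.NumberTheory.Automorphic.Liu2021.CheckOfChi                   -- ★ `HeckeCharacter.checkOfChi` (`χ̌(x) = χ(x_f ∕ x_fᶜ)`), `checkOfChi_apply` — the GLOBAL pin (hdχ) of ★ FILE 1 p845114
import HarnessLib

/-!
# Crux `H413`, programme P2 — road «S2♯-θ» FILE 3: **THE SPLIT-PLACE MEMBERSHIP CLAUSE FOR A THETA-TYPE `P`**
# (`mem_cmSplitPacket_of_isConstituentOf_theta`: every local constituent of `P` at a split place lies in the split packet of the dictionary `ξ`)

Cell hodgecm-mathlib (D-0151), FLOOR 0, crux item H413 = stmt-HodgeConjecture-24833, route of record `HCCMUnconditional` (no route verbs);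
programme P2 (theta ∕ `hdictE`).  Road «S2♯-θ» (F0P2-p06 (g9) FINDING 2026-09-01T15:01Z): the REL-ENGINE head
`Cruxes/H413/Lines/F0_P2E3RelEngine.lean :: relParity_of_engine` consumes the print letter S2♯ #80 `Rogawski1990.cohDiscrete_memXiFamily_archPinned` ONLY
through its FINITE clause `∃ ξ, MemXiFamily P … μω hμu ξ` (★ D6 `GlobalAPacketMembership`) and ONLY at THETA-type `P`, `P′` (`RelTarget` carries
`P.HasFinComponent (rhoAtLine … ιV a χ)`); that clause is provable in-house place by place.  FILE 1 ★ p845114 `F0P2uXiOfThetaDatum` (p06) = the forward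
dictionary `(μ, χ, μω) ↦ ξ` with the two pins (hdμ), (hdχ) + the non-split consequence over ★ #76; FILE 2 (p06) = the non-split membership clause;
THIS FILE (F0P2-p01 (g13)) = the SPLIT membership clause; FILE 4 (p01) = the assembly `∃ ξ, MemXiFamily P … ξ`.
THEOREMS ONLY (no `def`, no instance, no notation, no named fact, no `sorry`); never imports a `Cruxes/…/Lines` module (O50-1);
`--supports stmt-HodgeConjecture-24833`.  HONEST LABEL (D-0151): HC_CM is proved only modulo the printed citations until rung 0 closes; this file closes NO
print letter — it removes, for theta-type `P` at the SPLIT places, the need for letter #80 in the REL-ENGINE, using ★ theorems only.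

## THE STATEMENT
For a hermitian `H ∈ M₃(L)` (`hH`, `hHd`), a rational theta frame `(e₁, dV, g, ιV)` (`ιV k = g_f⁻¹ k g_f`), an automorphic measure and a discrete automorphic
`P` of `U(H)` with `P_f ↩ ω_H(μ, a, χ)` (★ `HasFinComponent` of Liu's carrier ★ `rhoAtLine … ιV a χ` at the `μ`-attached splittings), and a one-dimensional
automorphic `ξ = (η, ψ)` of `H′ = U(2) × U(1)` tied to `(μ, χ, μω)` by the two GLOBAL DICTIONARY PINS of ★ FILE 1 `exists_xi_dictionary` — (hdμ)
`μ̃ = η̃⁻¹ψ̃⁻¹μω`, (hdχ) `χ̌ = ψ̃⁻¹(η̃⁻¹ψ̃⁻¹μω)²` (their semi-local ∕ finite-idèle READINGS are derived inside, as in ★ `exists_xi_dictionary_pins`) —: at every place `v` of `L⁺` SPLIT in `L`, EVERY local constituent `c` of `P` at `v`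
(D6 (b2′) currency: `comap (localPiEquiv v) c` is a constituent of `P.finRep^∞ ∘ inclPlace v`) is THE member of the split packet
★ `cmSplitPacket L H hH hHd v w … (ξ.splitν₀ μω w) (ξ.locψ w) …` at D6's fixed witness `w = splitWitness v hs` — i.e. `c = ⟦i_G(ξ_w ⊗ μω_w ∘ det₀) ∘ cmSplitEquiv⟧`.

## THE PROOF (all ★; the FAM-TR ∕ GRD-(S) split plumbing run ONCE, absolutely instead of relatively)
(1) FLATH: `P.finRep^∞` is isotypic of the irreducible admissible `ω_H(a)` (★ `isotypicComponent_finRep_smoothPart_eq_top`, ★ `F0P2cStubCI`), and `ω_H(a) ∘ inclPlace v`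
is isotypic of the irreducible local theta type `τ_a = X_v(μ, a, χ) ∘ localLineInl ∘ κ_v⁻¹` (★ `F0P2cOmegaLocalType.isLocalTypeAt_rhoAtLine_chi`), so `c` read on
`localPi v` is `⟦r⟧` with `r.ρ ≃ τ_a` [Flath1979, Thm. 3; Liu2021, Def. 4.11, Lem. D.1 (1)].
(2) SPLIT MODEL: `τ_a ≃ I ∘ localPiSplitEquiv H` with `I = Ind_{Q_{2,1}}^{GL₃(L_w)}((μ̃_w ∘ det) ⊠ χ′_w μ̃_w^{1-3})`, `χ′_w` the `w`-reading of `χ` (★ p817128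
`F0P2iXvSplitModel.areIsomorphicRep_chiCoinv_chiLocalSplittingsD_split`, ★ p816908 `F0P2iGRDSplitTransport`; [Liu2021, App. D proof of Lem. D.1 ¶1; Rogawski1990,
Lemma 4.13.1 (b); Minguez2008, Thm. 1]).
(3) DICTIONARY: the pins give (Dν) `splitν₀ ξ μω w = μ̃_w` and (Dψ) `locψ ξ w = χ′_w μ̃_w^{1-3}` (★ p819322 `splitNu0_eq_localComponent_of_pin`,
`locPsi_eq_wReading_mul_zpow_of_pins`), so `I` IS the split member's representation `splitMemberGL L_w (splitν₀ ξ μω w) (locψ ξ w)` [Rogawski1990, §12.2 (2), §13.1 p. 199].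
(4) Hence `r.ρ ≃` (the member pulled back to `localPi v`), the classes agree (★ `IrrClass.mk_eq_mk_of_equiv`), and `comap (localPiEquiv v)` is injective
(★ `IrrClass.comap_injective`); the packet's member set is the singleton (★ `cmSplitPacket_members`).

## References
* [Rogawski1990] J. Rogawski, *Automorphic Representations of Unitary Groups in Three Variables*, Ann. of Math. Stud. 123 (1990): §4.13 p. 62, Lemma 4.13.1 (b);
  §12.2 (2) p. 174; §13.1 p. 199; §13.3 p. 201; §14.6 p. 246.
* [Liu2021] Y. Liu, *Fourier–Jacobi cycles and arithmetic relative trace formula*, Camb. J. Math. 9 (2021) = arXiv:2102.11518: Def. 4.11 (l. 2090–2096);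
  App. D §D.1, Lem. D.1 (1), proof of Lem. D.1 ¶1 (p. 126).
* [GelbartRogawski1991] S. Gelbart, J. Rogawski, Invent. Math. 105 (1991): §5.1 (5.1.1) p. 465, Lem. 5.1.2 p. 466.
* [Minguez2008] A. Mínguez, Ann. Sci. ÉNS 41 (2008): Thm. 1.  [Flath1979] D. Flath, PSPM 33.1 (1979), Thm. 3.  [Zelevinsky1980] Thm. 4.2.
-/

set_option autoImplicit false
-- the mandated namespace has the single-problem summit's repeated segment (`HodgeConjecture.HodgeConjecture`)
set_option linter.dupNamespace false

noncomputable section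

open scoped Matrix Kronecker MatrixGroups MonoidAlgebra ComplexOrder
open NumberField NumberField.InfinitePlace IsDedekindDomain MeasureTheory
open Literature.NumberTheory Literature.NumberTheory.Automorphic Literature.NumberTheory.Automorphic.UnitaryGroup
open Literature.NumberTheory.Automorphic.UnitaryGroup.CotangentForms
open Literature.NumberTheory.Automorphic.Liu2021 Literature.NumberTheory.Automorphic.Liu2021.AppendixC
open Literature.NumberTheory.Automorphic.Liu2021.Def411WeilCarriers
open Literature.NumberTheory.Automorphic.Liu2021.Def411WeilCarriersDoubling
open Literature.NumberTheory.Automorphic.IdeleClassGroup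
open Literature.NumberTheory.Automorphic.Liu2021.CheckOfChi
open Literature.NumberTheory.GelbartRogawski1991 Literature.NumberTheory.GelbartRogawski1991.UnitaryDualPair
open Literature.NumberTheory.GelbartRogawski1991.UnitaryDualPair.WeilCoinv
open Literature.NumberTheory.GelbartRogawski1991.UnitaryDualPair.LocalSplitting
open Literature.RepresentationTheory Literature.RepresentationTheory.Liu2021
open Literature.NumberTheory.GaloisRepresentations Literature.RepresentationTheory.HarrisKudlaSweet1996
open Literature.NumberTheory.Rogawski1990
open Summit.HodgeConjecture.CorCM
open Summit.HodgeConjecture.HodgeConjecture.Cruxes.H413.F0P2iGRDWitness (splitNu0_eq_localComponent_of_pin locPsi_eq_wReading_mul_zpow_of_pins)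

namespace Summit.HodgeConjecture.HodgeConjecture.Cruxes.H413.F0P2uThetaMemSplit

set_option synthInstance.maxHeartbeats 400000 in
set_option maxHeartbeats 16000000 in
/-- **S2♯-θ, SPLIT PLACES — EVERY LOCAL CONSTITUENT OF A THETA-TYPE `P` AT A SPLIT PLACE IS THE SPLIT PACKET MEMBER OF THE DICTIONARY `ξ`.**
For `H` hermitian with unit determinant, a rational theta frame `(e₁, dV, g, ιV)` (`ιV k = g_f⁻¹ k g_f`), a discrete automorphic `P` of `U(H)` with
`P_f ↩ ω_H(μ, a, χ)` (★ `HasFinComponent` of ★ `rhoAtLine … ιV a χ`), Rogawski's unitary `μω`, and `ξ : OneDimAutRepH L` satisfying the two GLOBAL dictionary pins of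
★ FILE 1 `F0P2uXiOfThetaDatum.exists_xi_dictionary` — (hdμ) `μ̃ = η̃⁻¹ψ̃⁻¹μω` and (hdχ) `χ̌ = ψ̃⁻¹(η̃⁻¹ψ̃⁻¹μω)²` (★ `HeckeCharacter.checkOfChi`, any `hcc`): at a place `v` of `L⁺`
SPLIT in `L`, every class `c` of `U(H)(L⁺_v)` whose pull-back along ★ `localPiEquiv v` is a constituent of `P.finRep^∞ ∘ inclPlace v` lies in
`(cmSplitPacket L H hH hHd v (splitWitness v hs) … (ξ.splitν₀ μω w) (ξ.locψ w) …).members` (= the singleton `{⟦i_G(ξ_w ⊗ μω_w ∘ det₀) ∘ cmSplitEquiv⟧}`,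
`w = splitWitness v hs`).  This is the split half of «the theta lift `Θ_μ(χ)` lies in `Π(ξ)`» [Rogawski1990, Lemma 4.13.1 (b), §12.2 (2), §13.1 p. 199;
GelbartRogawski1991, (5.1.1), Lem. 5.1.2], in D6's `LocalConstituentsIn` currency at one place.
[cite: Rogawski1990, §4.13 p. 62, Lemma 4.13.1 (b); §12.2 (2) p. 174; §13.1 p. 199; §13.3 p. 201] [cite: Liu2021, Def. 4.11 (l. 2090–2096); App. D Lem. D.1 (1), proof of Lem. D.1 ¶1 p. 126]
[cite: GelbartRogawski1991, §5.1 (5.1.1) p. 465, Lem. 5.1.2 p. 466] [cite: Minguez2008, Thm. 1] [cite: Flath1979, Thm. 3] [cite: Zelevinsky1980, Thm. 4.2] -/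
theorem mem_cmSplitPacket_of_isConstituentOf_theta
    (L : Type) [Field L] [NumberField L] [IsCMField L] (H : Matrix (Fin 3) (Fin 3) L) (hH : (H.map (cmConjRingHom L))ᵀ = H) (hHd : IsUnit H.det)
    {n' : ℕ} (e₁ : Fin 3 × Fin 1 ≃ Fin n') (dV : Fin 3 → L) (hdV : ∀ i, IsCMField.complexConj L (dV i) = dV i) (hdV0 : ∀ i, dV i ≠ 0)
    (g : GL (Fin 3) L)
    (hg : ((g : Matrix (Fin 3) (Fin 3) L).map (cmConjRingHom L))ᵀ * H * (g : Matrix (Fin 3) (Fin 3) L) = Matrix.diagonal dV)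
    (ιV : finAdelic (↥(maximalRealSubfield L)) L (IsCMField.complexConj L) 3 H →*
        finAdelic (↥(maximalRealSubfield L)) L (IsCMField.complexConj L) 3 (Matrix.diagonal dV))
    (hιV : ∀ k, ((ιV k : finAdelic (↥(maximalRealSubfield L)) L (IsCMField.complexConj L) 3 (Matrix.diagonal dV)) :
          GL (Fin 3) (FiniteAdeleRing (𝓞 L) L)) =
        (toFinAdeleGL L 3 g)⁻¹ * (k : GL (Fin 3) (FiniteAdeleRing (𝓞 L) L)) * toFinAdeleGL L 3 g)
    (μA : Measure (adelicGroupData (↥(maximalRealSubfield L)) L (IsCMField.complexConj L) 3 H).automorphicQuotient)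
    [(adelicGroupData (↥(maximalRealSubfield L)) L (IsCMField.complexConj L) 3 H).IsAutomorphicMeasure μA]
    (P : DiscreteAutomorphicRep (adelicGroupData (↥(maximalRealSubfield L)) L (IsCMField.complexConj L) 3 H) μA)
    (ξ : OneDimAutRepH L) (μω : HeckeCharacter L) (hμu : μω.IsUnitary)
    (μ : Literature.NumberTheory.Automorphic.IdeleClassGroup L →ₜ* Circle) (hμ : IsConjugateSymplectic L μ)
    (a : (↥(maximalRealSubfield L))ˣ) (χ : Chi (↥(maximalRealSubfield L)) L (IsCMField.complexConj L))
    (hcc : IsCMField.complexConj L * IsCMField.complexConj L = 1)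
    (hμξ : toHeckeCharacter L μ = ξ.bcη⁻¹ * ξ.bcψ⁻¹ * μω)
    (hχξ : HeckeCharacter.checkOfChi hcc χ = ξ.bcψ⁻¹ * (ξ.bcη⁻¹ * ξ.bcψ⁻¹ * μω) ^ 2)
    (hfin : P.HasFinComponent
      (rhoAtLine (↥(maximalRealSubfield L)) L (IsCMField.complexConj L) 3 e₁ (Matrix.diagonal dV)
        (complexConj_imagUnit L) (imagUnit_ne_zero L) (imagUnit_mul_self L) (realDiagonal_isSymm L dV hdV)
        (isUnit_det_realDiagonal L dV hdV hdV0) (realDiagonal_map L dV hdV).symm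
        (fun a => isCompatible_chiSplittingLine L e₁ dV hdV hdV0 (toHeckeCharacter L μ)
          (isUnitary_toHeckeCharacter L μ) ((isOscillatorChar_toHeckeCharacter_iff μ).mpr hμ)
          (TW (↥(maximalRealSubfield L)) a) (isSymm_TW (↥(maximalRealSubfield L)) a)
          (isUnit_det_TW (↥(maximalRealSubfield L)) a) (JW (↥(maximalRealSubfield L)) L a)
          (JW_eq (↥(maximalRealSubfield L)) L a)) ιV a χ))
    (v : HeightOneSpectrum (𝓞 ↥(maximalRealSubfield L)))
    (hs : ∃ w : PlacesOver L v, IsCMField.complexConj L • w.1 ≠ w.1)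
    (c : IrrClass ((cmDatum L 3 H).Local v))
    (hc : (IrrClass.comap (localPiEquiv L (IsCMField.complexConj L) 3 H v) c).IsConstituentOf
      (P.finRep.smoothPart.toRepresentation.comp (inclPlace (↥(maximalRealSubfield L)) L (IsCMField.complexConj L) 3 H v))) :
    c ∈ (cmSplitPacket L H hH hHd v (splitWitness v hs) (splitWitness_spec v hs) (ξ.splitν₀ μω (splitWitness v hs).1)
        (ξ.locψ (splitWitness v hs).1) (ξ.norm_splitν₀_apply hμu (splitWitness v hs).1)
        (ξ.continuous_splitν₀ μω (splitWitness v hs).1) (ξ.norm_locψ_apply (splitWitness v hs).1)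
        (ξ.continuous_locψ (splitWitness v hs).1)).members := by
  -- the frame is `3 × 1`
  obtain rfl : n' = 3 := by
    have h := Fintype.card_congr e₁
    simp only [Fintype.card_prod, Fintype.card_fin] at h
    omega
  set w : PlacesOver L v := splitWitness v hs with hwdef
  have hw : IsCMField.complexConj L • w.1 ≠ w.1 := splitWitness_spec v hs
  -- frame side conditions at `w`
  have hc1 : IsCMField.complexConj L ≠ 1 := IsCMField.complexConj_ne_one L
  have hHh : (H.map (IsCMField.complexConj L))ᵀ = H := (UnitaryGroup.map_cmConjRingHom_eq_map_complexConj L H) ▸ hH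
  have hHw : IsUnit (placeForm H w.1) := UnitaryGroup.isUnit_placeForm_of_isUnit_det hHd w.1
  have hJh := reindex_kronecker_JW_hermitian (↥(maximalRealSubfield L)) L (IsCMField.complexConj L) 3 e₁ (Matrix.diagonal dV)
    (realDiagonal_isSymm L dV hdV) (realDiagonal_map L dV hdV).symm a
  have hJw : IsUnit (placeForm (Matrix.reindex e₁ e₁ (Matrix.diagonal dV ⊗ₖ JW (↥(maximalRealSubfield L)) L a)) w.1) :=
    UnitaryGroup.isUnit_placeForm_of_isUnit_det
      (isUnit_iff_ne_zero.2 (det_reindex_kronecker_JW_ne_zero (↥(maximalRealSubfield L)) L 3 e₁ (Matrix.diagonal dV)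
        (isUnit_det_realDiagonal L dV hdV hdV0) (realDiagonal_map L dV hdV).symm a)) w.1
  have hχu := Def411WeilCarriers.norm_chi_eq_one_cm L χ
  -- the READINGS of the two global pins (as in ★ `F0P2uXiOfThetaDatum.exists_xi_dictionary_pins`): semi-local at `v`, finite-idèle for (hdχ)
  have hμξv : (toHeckeCharacter L μ).semilocalComponent L v = (ξ.bcη⁻¹ * ξ.bcψ⁻¹ * μω).semilocalComponent L v := by rw [hμξ]
  have hχξz : ∀ z : (FiniteAdeleRing (𝓞 L) L)ˣ,
      χ.1 (finAdelicCheck (↥(maximalRealSubfield L)) L (IsCMField.complexConj L) (Def411WeilCarriers.complexConj_mul_complexConj' L) z) =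
        (ξ.bcψ⁻¹ * (ξ.bcη⁻¹ * ξ.bcψ⁻¹ * μω) ^ 2)
          (Units.map (N := AdeleRing (𝓞 L) L) (MonoidHom.inr (InfiniteAdeleRing L) (FiniteAdeleRing (𝓞 L) L)) z) := by
    intro z
    have hfinz : idelicFinPart L (Units.map (N := AdeleRing (𝓞 L) L) (MonoidHom.inr (InfiniteAdeleRing L) (FiniteAdeleRing (𝓞 L) L)) z) = z :=
      Units.ext rfl
    have key : HeckeCharacter.checkOfChi hcc χ
        (Units.map (N := AdeleRing (𝓞 L) L) (MonoidHom.inr (InfiniteAdeleRing L) (FiniteAdeleRing (𝓞 L) L)) z) =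
        (ξ.bcψ⁻¹ * (ξ.bcη⁻¹ * ξ.bcψ⁻¹ * μω) ^ 2)
          (Units.map (N := AdeleRing (𝓞 L) L) (MonoidHom.inr (InfiniteAdeleRing L) (FiniteAdeleRing (𝓞 L) L)) z) := by rw [hχξ]
    rw [checkOfChi_apply, hfinz] at key
    exact key
  -- (3) the dictionary at `w`: (Dν), (Dψ)
  have hν : ξ.splitν₀ μω w.1 = (toHeckeCharacter L μ).localComponent w.1 :=
    splitNu0_eq_localComponent_of_pin L ξ μω μ v hμξv w
  have hψ : ξ.locψ w.1 =
      ((χ.1.comp (finAdelicCheck (↥(maximalRealSubfield L)) L (IsCMField.complexConj L) (Def411WeilCarriers.complexConj_mul_complexConj' L))).comp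
          (Units.map (finiteAdeleSingle w.1))) * ((toHeckeCharacter L μ).localComponent w.1) ^ (1 - ((3 : ℕ) : ℤ)) :=
    locPsi_eq_wReading_mul_zpow_of_pins L ξ μω μ χ.1 (Def411WeilCarriers.complexConj_mul_complexConj' L) hχξz v hμξv w
  -- (2) the X-side split model of Liu's local theta type at `w` (★ p817128), transported to `U(H)(L⁺_v)` (★ p816908)
  have hXI := F0P2iXvSplitModel.areIsomorphicRep_chiCoinv_chiLocalSplittingsD_split L hc1 (by norm_num) e₁ dV hdV hdV0
    (toHeckeCharacter L μ) ((isOscillatorChar_toHeckeCharacter_iff μ).mpr hμ) (isUnitary_toHeckeCharacter L μ) a χ.1 hχu χ.2.1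
    v w hw hJh hJw _ (F0P2iGRDSplit.wReading_det_eq_localCharOfCenter L a χ.1 v w hw)
  obtain ⟨Ea⟩ := F0P2iGRDSplitTransport.nonempty_equiv_comp_localLineInl_localCongr_symm L H dV g hg e₁
    (JW (↥(maximalRealSubfield L)) L a) v w hw hc1 hHh hHw hJh hJw _ _ hXI
  -- rewrite the model's Levi characters into the packet's labels
  rw [← hψ, ← hν] at Ea
  -- (1) Flath: the local type `τ_a` of `ω_H(a)` on `U(H)(L⁺_v)`; `P.finRep^∞` is `ω_H(a)`-isotypic; `c` read on `localPi v` is `≃ τ_a`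
  obtain ⟨hτ, hτtop⟩ := F0P2cOmegaLocalType.isLocalTypeAt_rhoAtLine_chi L H e₁ dV hdV hdV0 g hg ιV hιV μ hμ a χ v
  have hirr := F0P2cStubCI.rhoAtLine_chi_isIrreducible L H e₁ dV hdV hdV0 g hg ιV hιV μ hμ a χ
  have hadm := F0P2cStubCI.rhoAtLine_chi_isAdmissible L H e₁ dV hdV hdV0 g hg ιV hιV μ hμ a χ
  have htopP := F0P3FinPartIsotypic.isotypicComponent_finRep_smoothPart_eq_top P _ hirr hadm hfin
  haveI := hirr
  have h₁ := hc.of_isotypicComponent_eq_top_comp htopP (inclPlace (↥(maximalRealSubfield L)) L (IsCMField.complexConj L) 3 H v)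
  have h₂ := F0P2rFamTransferHolds.isConstituentOf_of_isotypicComponent_eq_top hτtop h₁
  obtain ⟨r, hr⟩ := IrrClass.mk_surjective (IrrClass.comap (localPiEquiv L (IsCMField.complexConj L) 3 H v) c)
  rw [← hr] at h₂
  obtain ⟨er⟩ := h₂.nonempty_equiv_of_isIrreducible
  -- (4) the member, pulled back to `localPi v`, IS the pulled-back model
  let r₀ : SmoothIrrep ↥(localPi L (IsCMField.complexConj L) 3 H v) :=
    ((splitMemberGL (w.1.adicCompletion L) (ξ.splitν₀ μω w.1) (ξ.locψ w.1) (ξ.norm_splitν₀_apply hμu w.1)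
        (ξ.continuous_splitν₀ μω w.1) (ξ.norm_locψ_apply w.1) (ξ.continuous_locψ w.1)).comap (cmSplitEquiv L H hH hHd v w hw)).comap
      (localPiEquiv L (IsCMField.complexConj L) 3 H v)
  have hmk : IrrClass.mk r₀ = IrrClass.comap (localPiEquiv L (IsCMField.complexConj L) 3 H v)
      (cmSplitPacket L H hH hHd v w hw (ξ.splitν₀ μω w.1) (ξ.locψ w.1) (ξ.norm_splitν₀_apply hμu w.1)
        (ξ.continuous_splitν₀ μω w.1) (ξ.norm_locψ_apply w.1) (ξ.continuous_locψ w.1)).πn := rfl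
  have eMem : r₀.ρ.Equiv
      (show Representation ℂ (localPi L (IsCMField.complexConj L) 3 H v) _ from
        (splitMemberGL (w.1.adicCompletion L) (ξ.splitν₀ μω w.1) (ξ.locψ w.1) (ξ.norm_splitν₀_apply hμu w.1)
          (ξ.continuous_splitν₀ μω w.1) (ξ.norm_locψ_apply w.1) (ξ.continuous_locψ w.1)).ρ.comp
          (localPiSplitEquiv (IsCMField.complexConj L) H hc1 hHh w hw hHw).toMonoidHom) := by
    refine Representation.Equiv.mk (LinearEquiv.refl ℂ _) fun u => ?_
    apply LinearMap.ext
    intro x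
    change (splitMemberGL (w.1.adicCompletion L) (ξ.splitν₀ μω w.1) (ξ.locψ w.1) (ξ.norm_splitν₀_apply hμu w.1)
          (ξ.continuous_splitν₀ μω w.1) (ξ.norm_locψ_apply w.1) (ξ.continuous_locψ w.1)).ρ
        (localPiSplitEquiv (IsCMField.complexConj L) H hc1 hHh w hw hHw
          ((localPiEquiv L (IsCMField.complexConj L) 3 H v).symm (localPiEquiv L (IsCMField.complexConj L) 3 H v u))) x = _
    rw [ContinuousMulEquiv.symm_apply_apply]
    rfl
  -- `⟦r⟧ = ⟦r₀⟧`, hence `c = πn`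
  have hcls : IrrClass.mk r = IrrClass.mk r₀ := IrrClass.mk_eq_mk_of_equiv ((er.trans Ea).trans eMem.symm)
  have hcπ : c = (cmSplitPacket L H hH hHd v w hw (ξ.splitν₀ μω w.1) (ξ.locψ w.1) (ξ.norm_splitν₀_apply hμu w.1)
      (ξ.continuous_splitν₀ μω w.1) (ξ.norm_locψ_apply w.1) (ξ.continuous_locψ w.1)).πn :=
    IrrClass.comap_injective (localPiEquiv L (IsCMField.complexConj L) 3 H v) (by rw [← hr, hcls, hmk])
  rw [cmSplitPacket_members, Set.mem_singleton_iff]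
  exact hcπ

end Summit.HodgeConjecture.HodgeConjecture.Cruxes.H413.F0P2uThetaMemSplit

end
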